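import Summits.NavierStokesRegularity.NavierStokesRegularity.Theses.SlicedKelvin
import Literature.Analysis.FluidPDE.CurlFreeLiouville
import Literature.Analysis.FluidPDE.NSBoundedMildOseenClassical
import HarnessLib

/-!
# Stub `stub_irrotationalConstant` of the birth line of crux `SlicedKelvin.PlanarFluxLiouville`

(crux item `stmt-NavierStokesRegularity-15601`, line `registered` = `Cruxes/PlanarFluxLiouville/Lines/birth.lean`.)

The kinematic exit stub of the skeleton: a smooth, bounded, weakly divergence-free, irrotational
vector field on `ℝ³` is constant (Koch–Nadirashvili–Seregin–Šverák 2009, Lemma 3.1: "bounded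
solutions of the system `curl z = 0`, `div z = 0` in `ℝⁿ` are constant by Liouville's theorem").
In tree this is the composition of
`Literature.Analysis.FluidPDE.IsWeaklyDivFree.isDivFree_of_contDiff` (weak ⇒ pointwise
solenoidality for `C¹` fields) with
`Literature.Analysis.FluidPDE.eq_of_curl_eq_zero_of_isDivFree_of_bounded` (each coordinate is a
bounded harmonic function; Liouville).
-/

noncomputable section

open Set MeasureTheory Filter Topology
open Literature.Analysis.FluidPDE

-- single-conjunct summit: `<Summit>.<Problem>` repeats the name (tree-wide convention, lakefile weak option)
set_option linter.dupNamespace false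

namespace Summit.NavierStokesRegularity.NavierStokesRegularity.Theorems.PlanarFluxLiouville.Birth

/-- **Stub `stub_irrotationalConstant`** (registered signature, verbatim): a smooth, bounded,
weakly divergence-free (`IsWeaklyDivFree`), irrotational (`curl u ≡ 0`) vector field on
`EuclideanSpace ℝ (Fin 3)` is constant. KNSS 2009, Lemma 3.1 (arXiv:0709.3599, p. 7); proof:
weak solenoidality upgrades to `div u = 0` for `C¹` fields
(`IsWeaklyDivFree.isDivFree_of_contDiff`), and a bounded `C²` field with `curl u = 0`,
`div u = 0` is constant (`eq_of_curl_eq_zero_of_isDivFree_of_bounded`, harmonic Liouville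
coordinatewise). -/
theorem stub_irrotationalConstant :
    ∀ (u : EuclideanSpace ℝ (Fin 3) → EuclideanSpace ℝ (Fin 3)),
      ContDiff ℝ (⊤ : ℕ∞) u → IsWeaklyDivFree u → (∃ C : ℝ, ∀ x, ‖u x‖ ≤ C) →
      (∀ x, curl u x = 0) → ∃ b : EuclideanSpace ℝ (Fin 3), ∀ x, u x = b := by
  intro u hu hdiv hbdd hcurl
  obtain ⟨C, hC⟩ := hbdd
  have h1 : ContDiff ℝ 1 u := hu.of_le (by norm_cast)
  have h2 : ContDiff ℝ 2 u := hu.of_le (by norm_cast)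
  have hdf : VectorCalculus.IsDivFree u := hdiv.isDivFree_of_contDiff h1
  exact ⟨u 0, fun x => eq_of_curl_eq_zero_of_isDivFree_of_bounded h2 hcurl hdf hC x 0⟩

end Summit.NavierStokesRegularity.NavierStokesRegularity.Theorems.PlanarFluxLiouville.Birth

end
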